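import Mathlib
import HarnessLib
import Summits.Parity.GeneralizedHardyLittlewood.Theses.LeeYangFibres
import Summits.Parity.GeneralizedHardyLittlewood.Theorems.LeeYangFibresModelHyperbolicity
import Summits.Parity.GeneralizedHardyLittlewood.Theorems.LeeYangFibresFibreHyperbolicityDefs

/-!
# Crux `FibreHyperbolicity` (stmt-Parity-14108), line "model transfer": the open residue in the route's currency

`stub_lawMany : ∀ t ≥ 2, CellModelLaw t` is the one open (Hardy–Littlewood-strength) stub of the line. This file
restates it in the vocabulary of the route's crux 3 `CellParityLaw` (stmt-Parity-14109): `GhostFreeCellLaw t` is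
LITERALLY the inequality of `CellParityLaw` with the Walsh amplitude `Σ_S θ_S ∏_{i∈S} (−1)^{j_i+1}` replaced by its
ghost-free value `1` (`θ = δ_∅`), i.e. "CellParityLaw and every parity ghost vanishes". We PROVE

* `stub_ghostBridge : ∀ t, GhostFreeCellLaw t → CellModelLaw t` (registered stub, PROVED here), using Alladi's cell asymptotics
  `A_m(N) log N / N → I_m(u)` (landed: `WindowChainTransport.stub_cellLimit`, `stub_cellRate`, `stub_calculus`) and
  `A_u(N) = 0`;

so that the crux is closed modulo `∀ t ≥ 2, GhostFreeCellLaw t` (registered stub `stub_ghostFree`) and the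
parity-free `t = 1` stubs, and — with the
route's support `HyperbolicityClipsParity` (`CellParityLaw → FibreHyperbolicity → ModelCellFacts → PrimeCellsRelative`)
— `FibreHyperbolicity` is, GIVEN `CellParityLaw`, equivalent to the vanishing of the ghosts: it is not an input
independent of the route's output.
-/

noncomputable section

namespace Summit.Parity.GeneralizedHardyLittlewood.Cruxes.FibreHyperbolicity.ModelTransfer

open scoped BigOperators Classical Topology
open Finset Filter
open Literature.NumberTheory.Sieve
open Summit.Parity.GeneralizedHardyLittlewood.Cruxes.ModelHyperbolicity.WindowChainTransport
  (cellDensity cellDensity_zero stub_calculus stub_cellRate stub_cellLimit calc_nonneg calc_pos CellAsymptotics)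
open Summit.Parity.GeneralizedHardyLittlewood.Theorems.ModelHyperbolicity.Negative (cell cell_eq_zero_of_le)

/-- **The ghost-free cell law for `t` forms**: the inequality of the route's `CellParityLaw` (crux 3) with the
Walsh amplitude replaced by `1` — every joint rough Ω-cell equals the independent-anatomy × singular-series
model `β_∞ 𝔖 ∏_i A_{j_i}(N)/N` up to `ε N / log^t N`, uniformly (`A_m(N) = #{m' ≤ N : P⁻(m') > N^{1/u}, Ω(m') = m}`).
At `t = 1` this is Alladi–Landau in a progression segment; at `t ≥ 2` it is a Hardy–Littlewood law for almost-prime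
cells with NO parity ghosts (open-problem strength). A statement, not a claim. -/
def GhostFreeCellLaw (t : ℕ) : Prop :=
  ∀ (L u : ℕ), 2 ≤ u → ∀ ε : ℝ, 0 < ε → ∃ N₀ : ℕ, ∀ N : ℕ, N₀ ≤ N →
    ∀ Ψ : Fin t → AffLinForm 1, IsNondegenerateSystem Ψ → affLinSize Ψ N ≤ L →
    ∀ K : Set (Fin 1 → ℝ), Convex ℝ K → K ⊆ realBox 1 N →
    ∀ j : Fin t → ℕ, (∀ i, 1 ≤ j i ∧ j i ≤ u) →
      |(jointCell t N u Ψ K j : ℝ) -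
          archFactor Ψ K * singularProduct Ψ *
            ∏ i, ((((Finset.Icc 1 N).filter (fun m => (N : ℝ) ^ ((1 : ℝ) / u) < (Nat.minFac m : ℝ) ∧
              ArithmeticFunction.cardFactors m = j i)).card : ℕ) : ℝ) / N| ≤ ε * N / Real.log N ^ t

/-! ## Elementary tools -/

/-- Product perturbation: `|∏ a − ∏ b| ≤ #s · B^{#s-1} · δ` when `|a_k|, |b_k| ≤ B` and `|a_k − b_k| ≤ δ`. -/
theorem abs_prod_sub_prod_le {ι : Type*} (s : Finset ι) (a b : ι → ℝ) {B δ : ℝ} (hB : 0 ≤ B) (hδ : 0 ≤ δ)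
    (ha : ∀ k ∈ s, |a k| ≤ B) (hb : ∀ k ∈ s, |b k| ≤ B) (hab : ∀ k ∈ s, |a k - b k| ≤ δ) :
    |∏ k ∈ s, a k - ∏ k ∈ s, b k| ≤ s.card * B ^ (s.card - 1) * δ := by
  classical
  induction s using Finset.induction_on with
  | empty => simp
  | @insert k s hk ih =>
    rw [Finset.prod_insert hk, Finset.prod_insert hk, Finset.card_insert_of_notMem hk]
    have ha' : ∀ k ∈ s, |a k| ≤ B := fun k hk' => ha k (Finset.mem_insert_of_mem hk')
    have hb' : ∀ k ∈ s, |b k| ≤ B := fun k hk' => hb k (Finset.mem_insert_of_mem hk')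
    have hab' : ∀ k ∈ s, |a k - b k| ≤ δ := fun k hk' => hab k (Finset.mem_insert_of_mem hk')
    have h1 := ih ha' hb' hab'
    have hpb : |∏ k ∈ s, b k| ≤ B ^ s.card := by
      rw [Finset.abs_prod]
      calc ∏ k ∈ s, |b k| ≤ ∏ _k ∈ s, B := Finset.prod_le_prod (fun k _ => abs_nonneg _) hb'
        _ = B ^ s.card := Finset.prod_const B
    have hak : |a k| ≤ B := ha k (Finset.mem_insert_self k s)
    have habk : |a k - b k| ≤ δ := hab k (Finset.mem_insert_self k s)
    calc |a k * ∏ k ∈ s, a k - b k * ∏ k ∈ s, b k|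
        = |a k * (∏ k ∈ s, a k - ∏ k ∈ s, b k) + (a k - b k) * ∏ k ∈ s, b k| := by ring_nf
      _ ≤ |a k| * |∏ k ∈ s, a k - ∏ k ∈ s, b k| + |a k - b k| * |∏ k ∈ s, b k| := by
          refine (abs_add_le _ _).trans ?_
          rw [abs_mul, abs_mul]
      _ ≤ B * (s.card * B ^ (s.card - 1) * δ) + δ * B ^ s.card := by
          gcongr
      _ ≤ (s.card + 1 : ℕ) * B ^ (s.card + 1 - 1) * δ := by
          rw [Nat.add_sub_cancel]
          rcases s.card.eq_zero_or_pos with h0 | hpos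
          · simp [h0]
          · have hBB : B * B ^ (s.card - 1) = B ^ s.card := by
              rw [← pow_succ', Nat.sub_add_cancel hpos]
            have hE : B * (s.card * B ^ (s.card - 1) * δ) + δ * B ^ s.card = (s.card + 1 : ℝ) * B ^ s.card * δ := by
              rw [← hBB]; ring
            rw [hE]
            push_cast
            exact le_rfl


/-- A lower bound for a product over a sub-family of numbers `≥ c` with `0 < c ≤ 1`: at least `c ^ (card of the
ambient type)`. -/
theorem pow_card_le_prod_filter {t : ℕ} (P : Fin t → Prop) [DecidablePred P] (f : Fin t → ℝ) {c : ℝ}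
    (hc0 : 0 ≤ c) (hc1 : c ≤ 1) (hf : ∀ k, P k → c ≤ f k) :
    c ^ t ≤ ∏ k ∈ Finset.univ.filter P, f k := by
  calc c ^ t ≤ c ^ (Finset.univ.filter P).card :=
        pow_le_pow_of_le_one hc0 hc1 (by simpa using Finset.card_filter_le (Finset.univ : Finset (Fin t)) P)
    _ = ∏ _k ∈ Finset.univ.filter P, c := (Finset.prod_const c).symm
    _ ≤ ∏ k ∈ Finset.univ.filter P, f k :=
        Finset.prod_le_prod (fun _ _ => hc0) fun k hk => hf k (Finset.mem_filter.mp hk).2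

/-- **The open residue in the route's currency.** The ghost-free cell law (= `CellParityLaw` with `θ = δ_∅`)
implies the line's `CellModelLaw` at every `t`: with `Λ := β_∞ 𝔖 / log^t N` the model main term
`β_∞ 𝔖 ∏_i A_{j_i}(N)/N` equals `Λ ∏_i (A_{j_i}(N) log N / N)`, Alladi's asymptotics
(`WindowChainTransport.stub_cellLimit`) replace each factor by `I_{j_i}(u)` (and `A_u(N) = 0 = I_u(u)`), the
absolute error `ε N / log^t N` is `≤ (ε/η) Λ` on admissible data (`ηN ≤ β_∞ 𝔖`), and `∏_{j_i < u} I_{j_i}(u)` is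
bounded below by a constant of `u, t`. -/
theorem stub_ghostBridge : ∀ t : ℕ, GhostFreeCellLaw t → CellModelLaw t := by
  intro t hG L u hu η hη ε hε
  have hAsy : CellAsymptotics u := stub_cellLimit stub_calculus (stub_cellRate stub_calculus) u hu
  -- positivity constant of the bulk densities `I_1(u), …, I_{u-1}(u)`
  have hne : (Finset.range (u - 1)).Nonempty := ⟨0, Finset.mem_range.mpr (by omega)⟩
  set cu : ℝ := (Finset.range (u - 1)).inf' hne (fun n => cellDensity n u) with hcu_def
  have hcu_pos : 0 < cu := by
    rw [hcu_def, Finset.lt_inf'_iff]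
    intro n hn
    exact calc_pos n u (by have := Finset.mem_range.mp hn; rw [show (u : ℝ) = ((u - 1 : ℕ) : ℝ) + 1 by
      rw [Nat.cast_sub (by omega)]; push_cast; ring]; exact_mod_cast Nat.succ_lt_succ this)
  have hcu_le : ∀ n, n + 1 < u → cu ≤ cellDensity n u := fun n hn =>
    Finset.inf'_le _ (Finset.mem_range.mpr (by omega))
  set c : ℝ := min 1 cu with hc_def
  have hc0 : 0 < c := lt_min one_pos hcu_pos
  have hc1 : c ≤ 1 := min_le_left _ _
  -- size constant
  set B : ℝ := ∑ n ∈ Finset.range u, cellDensity n u + 1 with hB_def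
  have hB1 : 1 ≤ B := by
    have : 0 ≤ ∑ n ∈ Finset.range u, cellDensity n u := Finset.sum_nonneg fun n _ => calc_nonneg _ _
    linarith
  have hIB : ∀ n, n < u → cellDensity n u ≤ B - 1 := fun n hn => by
    have := Finset.single_le_sum (f := fun n => cellDensity n u) (fun k _ => calc_nonneg k _) (Finset.mem_range.mpr hn)
    simp only [hB_def]; linarith
  -- accuracies
  have ht0 : (0 : ℝ) < (t : ℝ) * B ^ (t - 1) + 1 := by positivity
  set δ : ℝ := min 1 (ε * c ^ t / (4 * ((t : ℝ) * B ^ (t - 1) + 1))) with hδ_def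
  have hδ0 : 0 < δ := lt_min one_pos (by positivity)
  have hδ1 : δ ≤ 1 := min_le_left _ _
  have hδ_le : (t : ℝ) * B ^ (t - 1) * δ ≤ ε * c ^ t / 4 := by
    have h1 : δ ≤ ε * c ^ t / (4 * ((t : ℝ) * B ^ (t - 1) + 1)) := min_le_right _ _
    calc (t : ℝ) * B ^ (t - 1) * δ ≤ ((t : ℝ) * B ^ (t - 1) + 1) * δ := by
          refine mul_le_mul_of_nonneg_right (by linarith) hδ0.le
      _ ≤ ((t : ℝ) * B ^ (t - 1) + 1) * (ε * c ^ t / (4 * ((t : ℝ) * B ^ (t - 1) + 1))) :=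
          mul_le_mul_of_nonneg_left h1 ht0.le
      _ = ε * c ^ t / 4 := by field_simp
  set εG : ℝ := ε * c ^ t * η / 4 with hεG_def
  have hεG : 0 < εG := by positivity
  -- Alladi's asymptotics, uniformly over the finitely many cell indices
  have hclose : ∀ᶠ N : ℕ in atTop, ∀ n ∈ Finset.range u,
      |(cell u N (n + 1) : ℝ) * Real.log N / N - cellDensity n u| ≤ δ := by
    rw [Filter.eventually_all_finset]
    intro n _
    have h := hAsy n
    rw [Metric.tendsto_nhds] at h
    filter_upwards [h δ hδ0] with N hN
    rw [Real.dist_eq] at hN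
    exact hN.le
  obtain ⟨N₁, hN₁⟩ := Filter.eventually_atTop.mp hclose
  obtain ⟨N₂, hN₂⟩ := hG L u hu εG hεG
  refine ⟨max (max N₁ N₂) 2, fun N hN Ψ hΨ hsize K hK hKN hmass => ?_⟩
  have hN1 : N₁ ≤ N := le_trans (le_trans (le_max_left _ _) (le_max_left _ _)) hN
  have hN2 : N₂ ≤ N := le_trans (le_trans (le_max_right _ _) (le_max_left _ _)) hN
  have hN2' : (2 : ℕ) ≤ N := le_trans (le_max_right _ _) hN
  have hNpos : (0 : ℝ) < N := by exact_mod_cast (show 0 < N by omega)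
  have hlog : 0 < Real.log N := Real.log_pos (by exact_mod_cast (show 1 < N by omega))
  have hlogt : 0 < Real.log N ^ t := pow_pos hlog t
  -- the normaliser
  set M : ℝ := archFactor Ψ K * singularProduct Ψ with hM_def
  have hM : η * N ≤ M := hmass
  have hMpos : 0 < M := lt_of_lt_of_le (mul_pos hη hNpos) hM
  set Λ : ℝ := M / Real.log N ^ t with hΛ_def
  have hΛ : 0 < Λ := div_pos hMpos hlogt
  have hNΛ : (N : ℝ) / Real.log N ^ t ≤ Λ / η := by
    rw [hΛ_def, div_div, le_div_iff₀ (mul_pos hlogt hη)]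
    calc (N : ℝ) / Real.log N ^ t * (Real.log N ^ t * η) = η * N := by field_simp
      _ ≤ M := hM
  refine ⟨Λ, hΛ, fun j hj => ?_⟩
  have hjb : ∀ k, 1 ≤ j k ∧ j k ≤ u := fun k => Finset.mem_Icc.mp (Fintype.mem_piFinset.mp hj k)
  -- the normalised finite-N cell densities `a_k` and the model densities `I_k`
  set a : Fin t → ℝ := fun k => (cell u N (j k) : ℝ) * Real.log N / N with ha_def
  set I : Fin t → ℝ := fun k => cellDensity (j k - 1) u with hI_def
  have haI : ∀ k, |a k - I k| ≤ δ := by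
    intro k
    have h := hN₁ N hN1 (j k - 1) (Finset.mem_range.mpr (by have := hjb k; omega))
    rwa [show j k - 1 + 1 = j k from Nat.sub_add_cancel (hjb k).1] at h
  have hIle : ∀ k, |I k| ≤ B := by
    intro k
    rw [abs_of_nonneg (calc_nonneg _ _)]
    have := hIB (j k - 1) (by have := hjb k; omega)
    linarith
  have hale : ∀ k, |a k| ≤ B := by
    intro k
    have h1 := haI k
    have h2 : I k ≤ B - 1 := hIB (j k - 1) (by have := hjb k; omega)
    have h3 : 0 ≤ a k := by simp only [ha_def]; positivity
    rw [abs_of_nonneg h3]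
    have := abs_sub_le_iff.mp h1
    linarith
  -- the ghost-free law at this cell, rewritten with `Λ ∏ a`
  have hmain : M * ∏ k, ((cell u N (j k) : ℕ) : ℝ) / N = Λ * ∏ k, a k := by
    have e : ∀ k : Fin t, a k = ((cell u N (j k) : ℕ) : ℝ) / N * Real.log N := fun k => by
      simp only [ha_def]; ring
    simp only [e, Finset.prod_mul_distrib, Finset.prod_const, Finset.card_univ, Fintype.card_fin, hΛ_def]
    field_simp
  have hGj := hN₂ N hN2 Ψ hΨ hsize K hK hKN j hjb
  change |(jointCell t N u Ψ K j : ℝ) - M * ∏ k, ((cell u N (j k) : ℕ) : ℝ) / N| ≤ εG * N / Real.log N ^ t at hGj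
  rw [hmain] at hGj
  -- product perturbation
  have hprod : |∏ k, a k - ∏ k, I k| ≤ (t : ℝ) * B ^ (t - 1) * δ := by
    have h := abs_prod_sub_prod_le Finset.univ a I (by linarith) hδ0.le (fun k _ => hale k) (fun k _ => hIle k)
      (fun k _ => haI k)
    simpa [Finset.card_univ, Fintype.card_fin] using h
  -- lower bound for the bulk product
  have hbulk : c ^ t ≤ ∏ k ∈ Finset.univ.filter (fun k => j k < u), I k :=
    pow_card_le_prod_filter _ I hc0.le hc1 fun k hk =>
      (min_le_right _ _).trans (hcu_le (j k - 1) (by have := hjb k; omega))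
  -- assemble
  have e1 : εG * N / Real.log N ^ t ≤ ε * c ^ t / 4 * Λ := by
    calc εG * N / Real.log N ^ t = εG * (N / Real.log N ^ t) := by ring
      _ ≤ εG * (Λ / η) := mul_le_mul_of_nonneg_left hNΛ hεG.le
      _ = ε * c ^ t / 4 * Λ := by simp only [hεG_def]; field_simp
  have e2 : Λ * |∏ k, a k - ∏ k, I k| ≤ ε * c ^ t / 4 * Λ := by
    calc Λ * |∏ k, a k - ∏ k, I k| ≤ Λ * ((t : ℝ) * B ^ (t - 1) * δ) := mul_le_mul_of_nonneg_left hprod hΛ.le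
      _ ≤ Λ * (ε * c ^ t / 4) := mul_le_mul_of_nonneg_left hδ_le hΛ.le
      _ = ε * c ^ t / 4 * Λ := by ring
  calc |(jointCell t N u Ψ K j : ℝ) - Λ * ∏ k, cellDensity (j k - 1) u|
      = |((jointCell t N u Ψ K j : ℝ) - Λ * ∏ k, a k) + Λ * (∏ k, a k - ∏ k, I k)| := by
          congr 1; simp only [hI_def]; ring
    _ ≤ |(jointCell t N u Ψ K j : ℝ) - Λ * ∏ k, a k| + |Λ * (∏ k, a k - ∏ k, I k)| := abs_add_le _ _
    _ ≤ ε * c ^ t / 4 * Λ + ε * c ^ t / 4 * Λ := by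
          refine add_le_add (hGj.trans e1) ?_
          rw [abs_mul, abs_of_pos hΛ]; exact e2
    _ ≤ ε * Λ * c ^ t := by nlinarith [mul_pos hε hΛ, pow_pos hc0 t]
    _ ≤ ε * Λ * ∏ k ∈ Finset.univ.filter (fun k => j k < u), cellDensity (j k - 1) u :=
          mul_le_mul_of_nonneg_left hbulk (by positivity)

end Summit.Parity.GeneralizedHardyLittlewood.Cruxes.FibreHyperbolicity.ModelTransfer

end
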